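import Mathlib
import HarnessLib
import Summits.ValiantsHypothesis.ValiantsHypothesis.Theses.BarrierLever
import Summits.ValiantsHypothesis.ValiantsHypothesis.Theorems.BarrierLeverPartitionMinorsHitByVPHiddenStatesTropicalSigned
import Summits.ValiantsHypothesis.ValiantsHypothesis.Theorems.BarrierLeverPartitionMinorsHitByVPHiddenStatesBall
import Summits.ValiantsHypothesis.ValiantsHypothesis.Theorems.BarrierLeverPartitionMinorsHitByVPHiddenStatesFullJoinUniversal

/-!
# Route BarrierLever — item `PartitionMinorsHitByVP` (stmt-ValiantsHypothesis-19717), line `hidden_states`: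
# CONJECTURE TC (typed, not asserted) — «every row family has a SIGNED TROPICAL CERTIFICATE against the flat design» — and its kernel arrows

Helper file (`--supports stmt-ValiantsHypothesis-19717`; cell valiant-natproofs, rung V4, 𝒟-side door (c), line
`Cruxes/PartitionMinorsHitByVP/Lines/hidden_states.lean` v9; prover seat val-np-p3 gen 18). Two `def … : Prop` (typed conjectures, NOT
asserted) and three kernel arrows. Closes NO item; registry untouched (R26: by name only — TC is STRONGER than the one-sided node UTD).

WHY THIS STATEMENT (planner card v9p–v9r asked for «HL(K) as an explicit Lean `Stmt` with the kernel arrow HL → UTD»; the census of this seat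
says the right statement is TC, not HL). A valuation `w : states × coordinates → ℕ` turns the block-additive design matrix into a matrix of
integer polynomials whose top coefficient is the SIGNED, attainer-weighted count of the `w`-optimal assignments (`Tropical.coeff_det_tropM`,
p689724); a nonzero count is a certificate of goodness (`Tropical.det_ne_zero_of_signed_count`). The predecessor's HOME-BIJECTION LEX family (HL)
certifies exactly 7 062 / 7 448 down-sets of `2^[5]` at `K = 7`; THIS SEAT (kit j324314/5/7, signed count computed as the determinant of the 0/1
tight matrix of the optimal dual, 1 000 random directions of four generic kinds per instance): of the 386 HL failures, 385 ARE certified at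
`K = 7` by some GENERIC valuation (uniform / log-uniform / sparse / random lex order; 0 / 386 by random home-lex orders), 382 / 386 at `K = 8`
(500 directions), 386 / 386 at `K = 10` — certifying directions are rare (≈ 0.3 % of random directions) but exist. So «valuation certificates
are universal» survives where «home-lex certificates are universal» died; the cancellation mechanism of the predecessor's memo §3g (indicator
parallelograms) is a property of the HOME-LEX tight sets, not of valuations. CONJECTURE TC(Kf): for all large `h`, every `r ≤ 2^h` and every
injective row family `u`, the ball–colex (flat) design of size `r` on `Kf h` states admits a valuation with a non-cancelling signed count.

* `Tropical.Stmt.certified h K r u` — the per-instance statement (for EVERY ball–colex design `e` of size `r` on `K` states — there is one up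
  to the order of the columns, `exists_ballColex` — some valuation `w` and cost bound `D` attained by the optimal assignments have nonzero
  signed attainer-weighted count); `Tropical.ballGood_of_certified` — it implies `BallGood h K r u` (p553048's one-sided goodness) via p689724.
* `Tropical.Stmt.tropicalCertificates Kf` — TC(Kf), typed; `Tropical.universalThresholdDesign_of_tropicalCertificates` — for any state budget
  `h ≤ Kf h ≤ h³`, TC(Kf) ⇒ `FullJoin.Stmt.universalThresholdDesign` (UTD, p679900) — hence ⇒ node #1 `stub_universalJoinWide` (p683550) ⇒ the
  item; `Tropical.partitionMinorsHitByVP_of_tropicalCertificates` — the composite arrow to `PartitionMinorsHitByVP` (`b = 8`).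

CENSUS BEHIND THE CONJECTURE (this seat; all kit jobs `--workitem` 19717, auto-evidence): h = 4: every down-set certified at K = 5 (predecessor);
h = 5, K = 7: 7 447 / 7 448 down-sets certified (7 062 by HL + 385 of the 386 HL failures by generic directions; the last one, r = 28, is under a
deeper search j324546); K = 10: all. WHY IT MIGHT FAIL: a down-set whose design determinant has NO vertex of its term polytope in its support
(total cancellation at every extremal monomial) — then only genuinely algebraic (non-valuative) arguments remain; the coarse identity-home
certificates of this seat's K = h census (kit j323881/4/5) show that cancellation at the NATURAL extremal monomials is common (10–44 % of
down-sets in the middle range at h = 6, 7) and exactly self-dual under 𝒰 ↦ 𝒰* = {[h] ∖ V : V ∉ 𝒰}.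

WHAT THIS IS NOT: TC is a CONJECTURE (two `def`s); nothing here certifies a family; item 19717 OPEN; nothing on crux 14610 or VP ≠ VNP.
-/

set_option linter.dupNamespace false

namespace Summit.ValiantsHypothesis.ValiantsHypothesis.Theorems.BarrierLever.HiddenStates

open Finset Matrix

noncomputable section

namespace Tropical

variable {h K r : ℕ}

/-- **Signed tropical certificate for one row family (typed).** For EVERY ball–colex design `e` of size `r` on `K` states (injective, a strict
initial segment of the `ballWt` order) there are natural weights `w` on (base ∪ states) × coordinates and a cost level `D` bounding every
assignment such that the signed, attainer-weighted count of the assignments of cost exactly `D` is nonzero — the hypothesis of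
`det_ne_zero_of_signed_count` for the one-piece column family `k ↦ (0, e k)`. -/
@[conjecture] def Stmt.certified (h K r : ℕ) (u : Fin r → Finset (Fin h)) : Prop :=
  ∀ e : Fin r → Finset (Fin K), Function.Injective e →
    (∀ J, J ∉ Set.range e → ∀ i, ∑ k ∈ e i, ballWt K k < ∑ k ∈ J, ballWt K k) →
      ∃ (w : Fin 1 → Option (Fin K) → Fin h → ℕ) (D : ℕ),
        (∀ σ : Equiv.Perm (Fin r), ∑ k, cost w (u (σ k)) ((0 : Fin 1), e k) ≤ D) ∧
        (∑ σ : Equiv.Perm (Fin r), if ∑ k, cost w (u (σ k)) ((0 : Fin 1), e k) = D then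
            ((Equiv.Perm.sign σ : ℤˣ) : ℤ) * ∏ k, ∏ a ∈ u (σ k), (attain w ((0 : Fin 1), e k) a : ℤ) else 0) ≠ 0

/-- **A certified row family is ball-good** (`BallGood h K r u`, p553048): the power table of the certifying valuation makes the block-additive
matrix of `u` against the ball–colex design nonsingular (`det_ne_zero_of_signed_count`, p689724). -/
theorem ballGood_of_certified (u : Fin r → Finset (Fin h)) (hc : Stmt.certified h K r u) : BallGood h K r u := by
  intro e he hthr
  obtain ⟨w, D, hD, hne⟩ := hc e he hthr
  obtain ⟨tx, htx⟩ := det_ne_zero_of_signed_count u (fun k => ((0 : Fin 1), e k)) w D hD hne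
  exact ⟨tx 0, by simpa using htx⟩

/-- **CONJECTURE TC(Kf) (typed; not asserted).** With the state budget `Kf : ℕ → ℕ`: eventually in `h`, every injective row family of every size
`r ≤ 2^h` is certified against the ball–colex design on `Kf h` states. Census form of record: `Kf h = h + 2` (h = 4: all; h = 5: 7 447/7 448
down-sets, the last one under search); the hybrid universal design of the line allows any `h ≤ Kf h ≤ h³`. -/
@[conjecture] def Stmt.tropicalCertificates (Kf : ℕ → ℕ) : Prop :=
  ∃ h₁ : ℕ, ∀ h : ℕ, h₁ ≤ h → ∀ r : ℕ, r ≤ 2 ^ h →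
    ∀ u : Fin r → Finset (Fin h), Function.Injective u → Stmt.certified h (Kf h) r u

/-- **TC ⇒ UTD.** If every row family is certified against the ball–colex design on `Kf h` states, `h ≤ Kf h ≤ h³`, then that design is a universal
threshold design in the sense of `FullJoin.Stmt.universalThresholdDesign` (p679900): one design per `(h, r)`, good for EVERY injective row family. -/
theorem universalThresholdDesign_of_tropicalCertificates (Kf : ℕ → ℕ) (hK : ∀ h, h ≤ Kf h ∧ Kf h ≤ h * h * h)
    (H : Stmt.tropicalCertificates Kf) : FullJoin.Stmt.universalThresholdDesign := by
  classical
  obtain ⟨h₁, H⟩ := H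
  refine ⟨h₁, fun h hh r hr => ?_⟩
  obtain ⟨hlo, hhi⟩ := hK h
  have hrK : r ≤ 2 ^ Kf h := hr.trans (Nat.pow_le_pow_right (by norm_num) hlo)
  obtain ⟨e, he, hthr⟩ := exists_ballColex (Kf h) r hrK
  refine ⟨Kf h, e, ballWt (Kf h), hhi, he, hthr, fun u hu => ?_⟩
  exact ballGood_of_certified u (H h hh r hr u hu) e he hthr

/-- **TC ⇒ item 19717** (`b = 8`): the composite of `universalThresholdDesign_of_tropicalCertificates` with the one-sided node's arrow
`FullJoin.partitionMinorsHitByVP_of_universalThresholdDesign` (p679900). -/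
theorem partitionMinorsHitByVP_of_tropicalCertificates (Kf : ℕ → ℕ) (hK : ∀ h, h ≤ Kf h ∧ Kf h ≤ h * h * h)
    (H : Stmt.tropicalCertificates Kf) :
    Summit.ValiantsHypothesis.ValiantsHypothesis.Theses.BarrierLever.PartitionMinorsHitByVP :=
  FullJoin.partitionMinorsHitByVP_of_universalThresholdDesign (universalThresholdDesign_of_tropicalCertificates Kf hK H)

/-- The census budget `Kf h = h + 2` is admissible (`h ≤ h + 2 ≤ h³` for `h ≥ 2`), so TC(h ↦ h+2) restricted to `h ≥ 2` closes the item;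
stated with the budget `max (h+2) …` clipped to `h³` to keep the arrow unconditional in `h`. -/
theorem partitionMinorsHitByVP_of_tropicalCertificates_plusTwo
    (H : Stmt.tropicalCertificates fun h => min (h + 2) (h * h * h)) :
    Summit.ValiantsHypothesis.ValiantsHypothesis.Theses.BarrierLever.PartitionMinorsHitByVP := by
  refine partitionMinorsHitByVP_of_tropicalCertificates _ (fun h => ⟨?_, Nat.min_le_right _ _⟩) H
  rcases Nat.eq_zero_or_pos h with rfl | hpos
  · simp
  · refine le_min (by omega) ?_
    calc h = h * 1 * 1 := by ring
      _ ≤ h * h * h := by gcongr <;> omega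

/-! ## Appendix (same seat): unique optima are certificates; relabelling invariance -/

/-- Every attainer count is positive (the tropical maximum is attained), as an integer. -/
theorem attain_cast_ne_zero {m : ℕ} (w : Fin m → Option (Fin K) → Fin h → ℕ) (x : Fin m × Finset (Fin K)) (a : Fin h) :
    (attain w x a : ℤ) ≠ 0 := by
  have hpos := leadingCoeff_linPoly_pos w x a
  rw [leadingCoeff_linPoly] at hpos
  exact ne_of_gt hpos

/-- **A UNIQUE optimal assignment is a signed certificate.** If against every ball–colex design some valuation has a unique cost-maximising
assignment `κ` (the hypothesis of `det_ne_zero_of_unique_assignment`, p579287), the row family is `certified`: at the level `D = cost κ` the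
signed count has the single term `sign κ · ∏ attain ≠ 0`. (So HL-type / trace-type unique certificates feed the typed node TC directly.) -/
theorem Stmt.certified_of_unique (u : Fin r → Finset (Fin h))
    (hc : ∀ e : Fin r → Finset (Fin K), Function.Injective e →
      (∀ J, J ∉ Set.range e → ∀ i, ∑ k ∈ e i, ballWt K k < ∑ k ∈ J, ballWt K k) →
      ∃ (w : Fin 1 → Option (Fin K) → Fin h → ℕ) (κ : Equiv.Perm (Fin r)),
        ∀ σ : Equiv.Perm (Fin r), σ ≠ κ →
          ∑ k, cost w (u (σ k)) ((0 : Fin 1), e k) < ∑ k, cost w (u (κ k)) ((0 : Fin 1), e k)) :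
    Stmt.certified h K r u := by
  classical
  intro e he hthr
  obtain ⟨w, κ, huniq⟩ := hc e he hthr
  refine ⟨w, ∑ k, cost w (u (κ k)) ((0 : Fin 1), e k), ?_, ?_⟩
  · intro σ
    by_cases hσ : σ = κ
    · subst hσ; exact le_rfl
    · exact (huniq σ hσ).le
  · rw [Finset.sum_eq_single κ]
    · rw [if_pos rfl]
      refine mul_ne_zero (Units.ne_zero _) ?_
      exact Finset.prod_ne_zero_iff.mpr fun k _ =>
        Finset.prod_ne_zero_iff.mpr fun a _ => attain_cast_ne_zero w ((0 : Fin 1), e k) a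
    · intro σ _ hσ
      rw [if_neg (ne_of_lt (huniq σ hσ))]
    · intro hκ
      exact absurd (Finset.mem_univ κ) hκ

/-- **Relabelling the coordinates preserves certification**: a valuation for `u` transported along a permutation `π` of `Fin h` certifies
`π ∘ u` (the design lives on the state side and is untouched). -/
theorem Stmt.certified_map (u : Fin r → Finset (Fin h)) (π : Equiv.Perm (Fin h)) (hc : Stmt.certified h K r u) :
    Stmt.certified h K r (fun i => (u i).map π.toEmbedding) := by
  classical
  intro e he hthr
  obtain ⟨w, D, hD, hne⟩ := hc e he hthr
  -- transported valuation: `w' p o a = w p o (π⁻¹ a)`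
  refine ⟨fun p o a => w p o (π.symm a), D, ?_, ?_⟩
  · intro σ
    have hcost : ∀ k, cost (fun p o a => w p o (π.symm a)) ((u (σ k)).map π.toEmbedding) ((0 : Fin 1), e k)
        = cost w (u (σ k)) ((0 : Fin 1), e k) := by
      intro k
      unfold cost mu
      rw [Finset.sum_map]
      refine Finset.sum_congr rfl fun a _ => ?_
      simp [Equiv.symm_apply_apply]
    simpa [hcost] using hD σ
  · have hcost : ∀ (σ : Equiv.Perm (Fin r)) k,
        cost (fun p o a => w p o (π.symm a)) ((u (σ k)).map π.toEmbedding) ((0 : Fin 1), e k)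
          = cost w (u (σ k)) ((0 : Fin 1), e k) := by
      intro σ k
      unfold cost mu
      rw [Finset.sum_map]
      refine Finset.sum_congr rfl fun a _ => ?_
      simp [Equiv.symm_apply_apply]
    have hatt : ∀ (σ : Equiv.Perm (Fin r)) k,
        ∏ a ∈ (u (σ k)).map π.toEmbedding, (attain (fun p o a => w p o (π.symm a)) ((0 : Fin 1), e k) a : ℤ)
          = ∏ a ∈ u (σ k), (attain w ((0 : Fin 1), e k) a : ℤ) := by
      intro σ k
      rw [Finset.prod_map]
      refine Finset.prod_congr rfl fun a _ => ?_
      simp [attain, mu, Equiv.symm_apply_apply]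
    simp_rw [hcost, hatt]
    exact hne

/-! ## Appendix 2 (same seat): the PROJECTION-HOME form (conjecture PH, typed) -/

/-- **Projection-home certificate (typed).** A valuation of the special shape «top weight `B` on the pairs `(q, η q)` for a map
`η : states → coordinates`, plus an arbitrary tail» that certifies `u` against every ball–colex design: the shape found to certify EVERY
down-set of `2^[5]` at `K = 7` (surjective `η`, generic small tail; kit j325249 of this seat) and, together with its degenerate forms, at
`K = 6`. At the top level the design member `J` is replaced by its image `η(J)` and the assignment maximises the total overlap `Σ |U ∩ η(J)|`;
the tail breaks the ties. -/
@[conjecture] def Stmt.homeCertified (h K r : ℕ) (u : Fin r → Finset (Fin h)) : Prop :=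
  ∀ e : Fin r → Finset (Fin K), Function.Injective e →
    (∀ J, J ∉ Set.range e → ∀ i, ∑ k ∈ e i, ballWt K k < ∑ k ∈ J, ballWt K k) →
      ∃ (η : Fin K → Fin h) (B : ℕ) (t : Option (Fin K) → Fin h → ℕ) (D : ℕ),
        (∀ o a, t o a < B) ∧
        let w : Fin 1 → Option (Fin K) → Fin h → ℕ :=
          fun _ o a => (match o with | none => 0 | some q => if η q = a then B else 0) + t o a
        (∀ σ : Equiv.Perm (Fin r), ∑ k, cost w (u (σ k)) ((0 : Fin 1), e k) ≤ D) ∧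
        (∑ σ : Equiv.Perm (Fin r), if ∑ k, cost w (u (σ k)) ((0 : Fin 1), e k) = D then
            ((Equiv.Perm.sign σ : ℤˣ) : ℤ) * ∏ k, ∏ a ∈ u (σ k), (attain w ((0 : Fin 1), e k) a : ℤ) else 0) ≠ 0

/-- A projection-home certificate is a certificate. -/
theorem Stmt.certified_of_homeCertified (u : Fin r → Finset (Fin h)) (hc : Stmt.homeCertified h K r u) :
    Stmt.certified h K r u := by
  intro e he hthr
  obtain ⟨η, B, t, D, _, hD, hne⟩ := hc e he hthr
  exact ⟨_, D, hD, hne⟩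

/-- **CONJECTURE PH(Kf) (typed; not asserted)**: eventually every injective row family has a projection-home certificate against the
ball–colex design on `Kf h` states. Census (this seat): h = 5 — all 7 448 down-sets at K = 7 (surjective homes) and at K = 6 (homes with a
dead or pure part); h = 6 — 679 / 694 sampled down-sets at K = 7 within 1 000 structured directions (deep retry pending). PH ⇒ TC. -/
@[conjecture] def Stmt.projectionHomes (Kf : ℕ → ℕ) : Prop :=
  ∃ h₁ : ℕ, ∀ h : ℕ, h₁ ≤ h → ∀ r : ℕ, r ≤ 2 ^ h →
    ∀ u : Fin r → Finset (Fin h), Function.Injective u → Stmt.homeCertified h (Kf h) r u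

/-- PH ⇒ TC (hence ⇒ UTD ⇒ node #1 ⇒ item, by the arrows above). -/
theorem Stmt.tropicalCertificates_of_projectionHomes (Kf : ℕ → ℕ) (H : Stmt.projectionHomes Kf) :
    Stmt.tropicalCertificates Kf := by
  obtain ⟨h₁, H⟩ := H
  exact ⟨h₁, fun h hh r hr u hu => Stmt.certified_of_homeCertified u (H h hh r hr u hu)⟩

/-- PH ⇒ item 19717 (`b = 8`), for any budget `h ≤ Kf h ≤ h³`. -/
theorem partitionMinorsHitByVP_of_projectionHomes (Kf : ℕ → ℕ) (hK : ∀ h, h ≤ Kf h ∧ Kf h ≤ h * h * h)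
    (H : Stmt.projectionHomes Kf) :
    Summit.ValiantsHypothesis.ValiantsHypothesis.Theses.BarrierLever.PartitionMinorsHitByVP :=
  partitionMinorsHitByVP_of_tropicalCertificates Kf hK (Stmt.tropicalCertificates_of_projectionHomes Kf H)

end Tropical

end

end Summit.ValiantsHypothesis.ValiantsHypothesis.Theorems.BarrierLever.HiddenStates
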